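import Summits.QuantumFields.BalabanUV.Beta.D1BFx.KernelMassTotal
import Summits.QuantumFields.BalabanUV.Beta.D1BFx.PackedCoframePairLimit

/-!
# `BalabanUV.Beta.D1BFx.CoframeWordShapes` — road «BF-x» for binder row D1, slot (K), (II)-row (C2) «TB4-W CO-FRAME TABLE, m-UNIFORM MASS», FILE δ1
# «COFRAME SHAPES»: **THE TOTAL MASSES OF THE FOUR BOND-SANDWICH SHAPES `dSw ∕ jetCw ∕ jetRw ∕ jetRCw` OF THE P4b WORDS FROM THEIR PIECES, AND THE
# DIAGONAL-WEIGHT ∕ SHIFT CALCULUS THE PIECES ARE BUILT FROM** (count half of (C2), OWNER RULING ρ-g19-1 AMENDED l.43347; W-1 l.43312 (F2))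

HONEST DEPENDENCY (cell records, verbatim): «continuum YM on T⁴ ⇐ BetaPertH ∧ nine spine estimates (0/9 proved); BetaPertH ⇐ (D1) ∧ (D4) ∧
CAP+tail; G-an2-4 gates asym, D1 and NE2/3/4.»  HONEST FRAMING (cell contract, verbatim): «discharging `BetaPertH` makes Bałaban's UV stability
UNCONDITIONAL — a real constructive-QFT result; it is NOT the continuum limit and NOT the Clay problem.»  THIS MODULE DISCHARGES NOTHING of the
wall: [folklore] `ℓ¹` bookkeeping (shifts `x ↦ x+s` as `Equiv.addRight`, `hasSum_ite_eq`, `Function.Injective.hasSum_iff` for graph-supported kernels, the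
triangle inequality for `|·|₁`) over α1∕α2's predicates `RowMass ∕ ColMass ∕ TotMass`, on `Site 4 = ℤ⁴` with `Unit` fibre.  No definition,
no `def … : Prop`, nothing cited, 0 sorry.  0 root-level binders of row D1 discharged (hW ∕ hR-sockets ∕ hSX-socket ∕ D1Tel ∕ D1Rep = 0); (K) NOT closed;
(C1)(C2) NOT closed here; NOT D1, NOT `BetaPertH`, NOT continuum, NOT Clay.

ABSOLUTE RULE (cell charter, verbatim): «No internally-minted statement may enter as a cited fact. Every hypothesis is either kernel-proved in
this package or a verbatim quotation of a PUBLISHED theorem with page reference. The manuscript(s) under audit are NOT citable for their own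
disputed steps — they are the thing under adjudication; programme-internal (2001/route/tribunal) claims are never citable.»

WHY.  `cofPairInf n a w w′` (`PackedCoframePairLimit`) is `2 •` a sum of nine `Fin 4`-fibred tables, each a `dSw`, `jetCw`, `jetRw` or `jetRCw` of a
composition word in the legs `lapU∘Cgh`, `Cgh`, `Cgh∘lapU`, `Rgt` and the vertices `gW w`, `qW w`, `d2W w w′`.  The (C2) letter is a TOTAL mass; this file
reduces the total mass of each shape to the total masses of its PIECES — kernels `x z ↦ ω z·Y (x+s) (z+t)` — and supplies the algebra that turns a piece
into a composition `V_s ∘ B_t ∘ diag ω` to which α2's `totMass_sandwich` applies (FILE δ1b `CoframeWordPieces`).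

CONTENT (all [folklore]; `D = 4`, `Unit` fibre).
* §1 `fib_unit`, `totMass_shift` (shift invariance), `totMass_of_components` (sixteen `Unit` components ↦ one `Fin 4` kernel), **`totMass_dSw`**:
  `TotMass Y M → TotMass (dSw Y) (64·M)`.
* §2 **`totMass_jetCw_of_pieces`** (`∀ β s, TotMass (x z ↦ ω β z·Y (x+s) (z+e_β)) T ⟹ TotMass (jetCw ω Y) (32·T)`), `jetRw_eq_trK_jetCw`
  (`jetRw ω Y = trK (jetCw ω (trK Y))` — sites AND bond indices swap), **`totMass_jetRw_of_pieces`**, **`totMass_jetRCw_of_pieces`** (`16·T`).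
* §3 `mul_diag_right ∕ left` (a column ∕ row weight IS a composition with the diagonal kernel `x z ↦ [x = z]·ω x`), `rowFn_diag`, `hasSum_diag_row ∕ col`,
  `rowMass_diag ∕ colMass_diag ∕ rows_diag ∕ cols_diag ∕ totMass_diag`, `totMass_rowGraph ∕ totMass_colGraph` (graph-supported kernels),
  `rowMass_rowShift` (`× e^{θ|s|₁}`), `rowMass_rowShift_zero`, `rowMass_colShift` (`× e^{θ|t|₁}`), `colMass_shift2_zero`, `cols_shift2` (localised columns,
  `× e^{κ|t|₁}`), `weight_le`, **`tsum_prodWeight_le`** (`|ϖ z| ≤ P₀·e^{−κ|z−c|₁}·e^{−κ|z−c′|₁}`, `0 ≤ θ < κ` ⟹ `Σ'|ϖ| ≤ P₀·Zl 4 (κ−θ)·e^{−θ|c−c′|₁}`).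
NOT HERE: the pieces as sandwiches (δ1b `CoframeWordPieces`), the vertices `gW ∕ d2W` in closed form (δ2 `CoframeVertices`), the sixteen words (δ3).
Unit `b2b-balaban-gan24-formalise-leaf-05` (gen 54), G-an2-4 swarm leaf prover 05, road «BF-x» (C1)(C2) count owner; INTENT «COFRAME SHAPES» (journal).
-/


noncomputable section

namespace Summit.QuantumFields.BalabanUV.Beta.D1BFx.CoframeWordShapes

open scoped BigOperators
open Finset
open Literature.MathematicalPhysics.QuantumFieldTheory.Balaban1983to89
open Literature.MathematicalPhysics.QuantumFieldTheory.Balaban1983to89.Beta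
open B12Sec2to5 (l1 l1_nonneg)
open ExpKernelCalculus (Site MKer comp Zl Zl_pos l1_sub_triangle l1_sub_symm summable_exp_shift' tsum_exp_shift')
open AffineAveraging (unitVec)
open OneStepResolventKernel (wsum)
open Summit.QuantumFields.BalabanUV.Beta.TameKernelCalculus (trK trK_trK)
open Summit.QuantumFields.BalabanUV.Beta.D1BFx.RJetAssembly (dSw)
open Summit.QuantumFields.BalabanUV.Beta.D1BFx.PackedPinnedLetters (jetRw jetCw jetRCw)
open Summit.QuantumFields.BalabanUV.Beta.D1BFx.GhostStencil (ghCur ghCur_apply l1_unitVec l1_zero)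
open Summit.QuantumFields.BalabanUV.Beta.D1BFx.PackedCoframeSiteWords (gW)
open Summit.QuantumFields.BalabanUV.Beta.D1BFx.KernelMassCalculus
open Summit.QuantumFields.BalabanUV.Beta.D1BFx.KernelMassTotal

/-! ## §1 Shifts and the `dSw` sandwich -/

/-- [folklore] For a `Unit`-fibred kernel the fibre mass is `|Y x z|`. -/
theorem fib_unit (Y : MKer 4 Unit) (x z : Site 4) : ∑ a : Unit, ∑ b : Unit, |Y x z a b| = |Y x z () ()| := by simp

/-- [folklore] **SHIFT INVARIANCE OF THE TOTAL MASS** (`Unit` fibre): `TotMass Y M → TotMass (x z ↦ Y (x+s) (z+t)) M`. -/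
theorem totMass_shift {Y : MKer 4 Unit} {M : ℝ} (h : TotMass Y M) (s t : Site 4) :
    TotMass (fun x z (a b : Unit) => Y (x + s) (z + t) a b) M := by
  obtain ⟨hs, hle⟩ := h
  set σ : Site 4 × Site 4 ≃ Site 4 × Site 4 := (Equiv.addRight s).prodCongr (Equiv.addRight t) with hσ
  have e : (fun p : Site 4 × Site 4 => ∑ a : Unit, ∑ b : Unit, |Y (p.1 + s) (p.2 + t) a b|)
      = (fun p : Site 4 × Site 4 => ∑ a : Unit, ∑ b : Unit, |Y p.1 p.2 a b|) ∘ σ := by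
    funext p; rfl
  refine ⟨?_, ?_⟩
  · show Summable fun p : Site 4 × Site 4 => ∑ a : Unit, ∑ b : Unit, |Y (p.1 + s) (p.2 + t) a b|
    rw [e]; exact (σ.summable_iff).2 hs
  · show ∑' p : Site 4 × Site 4, ∑ a : Unit, ∑ b : Unit, |Y (p.1 + s) (p.2 + t) a b| ≤ M
    rw [e]
    exact (Equiv.tsum_eq σ (fun p : Site 4 × Site 4 => ∑ a : Unit, ∑ b : Unit, |Y p.1 p.2 a b|)).trans_le hle

/-- [folklore] A `Fin 4 × Fin 4`-indexed family of `Unit` kernels read as ONE `Fin 4`-fibred kernel: its total mass is the sum of the sixteen. -/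
theorem totMass_of_components {K : MKer 4 (Fin 4)} {M : Fin 4 → Fin 4 → ℝ}
    (h : ∀ α β, TotMass (fun x z (_ _ : Unit) => K x z α β) (M α β)) : TotMass K (∑ α, ∑ β, M α β) := by
  have hs : ∀ α β, Summable fun p : Site 4 × Site 4 => |K p.1 p.2 α β| := fun α β => by
    have := (h α β).1; simpa using this
  have hle : ∀ α β, ∑' p : Site 4 × Site 4, |K p.1 p.2 α β| ≤ M α β := fun α β => by
    have := (h α β).2; simpa using this
  refine ⟨summable_sum fun α _ => summable_sum fun β _ => hs α β, ?_⟩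
  rw [Summable.tsum_finsetSum (fun α _ => summable_sum fun β _ => hs α β)]
  refine Finset.sum_le_sum fun α _ => ?_
  rw [Summable.tsum_finsetSum (fun β _ => hs α β)]
  exact Finset.sum_le_sum fun β _ => hle α β

/-- [folklore] **THE `dSw` SANDWICH COSTS `64`**: `TotMass Y M → TotMass (dSw Y) (64·M)` (four shifted copies per bond-index pair, sixteen pairs). -/
theorem totMass_dSw {Y : MKer 4 Unit} {M : ℝ} (h : TotMass Y M) : TotMass (dSw Y) (64 * M) := by
  have hcomp : ∀ α β : Fin 4, TotMass (fun x z (_ _ : Unit) => dSw Y x z α β) (M + M + M + M) := by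
    intro α β
    have h1 := totMass_shift h (unitVec α) (unitVec β)
    have h2 := totMass_shift h (unitVec α) 0
    have h3 := totMass_shift h 0 (unitVec β)
    have h4 := totMass_shift h 0 0
    have e : (fun x z (_ _ : Unit) => dSw Y x z α β)
        = ((fun x z (a b : Unit) => Y (x + unitVec α) (z + unitVec β) a b) - (fun x z (a b : Unit) => Y (x + unitVec α) (z + 0) a b))
          - (fun x z (a b : Unit) => Y (x + 0) (z + unitVec β) a b) + (fun x z (a b : Unit) => Y (x + 0) (z + 0) a b) := by
      funext x z a b; simp only [dSw, Pi.sub_apply, Pi.add_apply, add_zero]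
    rw [e]
    exact totMass_add (totMass_sub (totMass_sub h1 h2) h3) h4
  refine totMass_mono (totMass_of_components hcomp) (le_of_eq ?_)
  simp only [Finset.sum_const, Finset.card_univ, Fintype.card_fin, nsmul_eq_mul]; ring

/-! ## §2 The jet words `jetCw`, `jetRw`, `jetRCw` from their pieces -/

section Jets

variable {Y : MKer 4 Unit} {ω ω' : Fin 4 → Site 4 → ℝ} {T : ℝ}

/-- [folklore] **`jetCw` FROM ITS PIECES**: `TotMass (x z ↦ ω β z·Y (x+s) (z+e_β)) T` for every `β` and `s ∈ {0, e_α}` ⟹ `TotMass (jetCw ω Y) (32·T)`. -/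
theorem totMass_jetCw_of_pieces (h : ∀ (β : Fin 4) (s : Site 4), TotMass (fun x z (_ _ : Unit) => ω β z * Y (x + s) (z + unitVec β) () ()) T) :
    TotMass (jetCw ω Y) (32 * T) := by
  have hcomp : ∀ α β : Fin 4, TotMass (fun x z (_ _ : Unit) => jetCw ω Y x z α β) (T + T) := by
    intro α β
    have h1 := h β (unitVec α)
    have h2 := h β 0
    have e : (fun x z (_ _ : Unit) => jetCw ω Y x z α β)
        = (fun x z (_ _ : Unit) => ω β z * Y (x + unitVec α) (z + unitVec β) () ()) - (fun x z (_ _ : Unit) => ω β z * Y (x + 0) (z + unitVec β) () ()) := by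
      funext x z a b; simp only [jetCw, Pi.sub_apply, add_zero, mul_sub]
    rw [e]; exact totMass_sub h1 h2
  refine totMass_mono (totMass_of_components hcomp) (le_of_eq ?_)
  simp only [Finset.sum_const, Finset.card_univ, Fintype.card_fin, nsmul_eq_mul]; ring

/-- [folklore] **`jetRw` IS THE TRANSPOSE OF `jetCw` OF THE TRANSPOSE**: `jetRw ω Y = trK (jetCw ω (trK Y))` (sites AND bond indices swap). -/
theorem jetRw_eq_trK_jetCw (ω : Fin 4 → Site 4 → ℝ) (Y : MKer 4 Unit) : jetRw ω Y = trK (jetCw ω (trK Y)) := by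
  funext x z α β
  simp only [jetRw, jetCw, TameKernelCalculus.trK]

/-- [folklore] **`jetRw` FROM THE PIECES OF THE TRANSPOSED WORD**: `TotMass (jetRw ω Y) (32·T)` from the `jetCw`-pieces of `trK Y`. -/
theorem totMass_jetRw_of_pieces (h : ∀ (β : Fin 4) (s : Site 4), TotMass (fun x z (_ _ : Unit) => ω β z * trK Y (x + s) (z + unitVec β) () ()) T) :
    TotMass (jetRw ω Y) (32 * T) := by
  rw [jetRw_eq_trK_jetCw]; exact totMass_trK (totMass_jetCw_of_pieces h)

/-- [folklore] **`jetRCw` FROM ITS PIECES**: `TotMass (x z ↦ ω α x·ω′ β z·Y (x+e_α) (z+e_β)) T` for all `α β` ⟹ `TotMass (jetRCw ω ω′ Y) (16·T)`. -/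
theorem totMass_jetRCw_of_pieces
    (h : ∀ α β : Fin 4, TotMass (fun x z (_ _ : Unit) => ω α x * ω' β z * Y (x + unitVec α) (z + unitVec β) () ()) T) :
    TotMass (jetRCw ω ω' Y) (16 * T) := by
  have hcomp : ∀ α β : Fin 4, TotMass (fun x z (_ _ : Unit) => jetRCw ω ω' Y x z α β) T := by
    intro α β
    have e : (fun x z (_ _ : Unit) => jetRCw ω ω' Y x z α β)
        = fun x z (_ _ : Unit) => ω α x * ω' β z * Y (x + unitVec α) (z + unitVec β) () () := by
      funext x z a b; simp only [jetRCw]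
    rw [e]; exact h α β
  refine totMass_mono (totMass_of_components hcomp) (le_of_eq ?_)
  simp only [Finset.sum_const, Finset.card_univ, Fintype.card_fin, nsmul_eq_mul]; ring

end Jets

/-! ## §3 Diagonal weights and shifted kernels -/

section DiagShift

variable (ω : Site 4 → ℝ) (K : MKer 4 Unit)

/-- [folklore] **A COLUMN WEIGHT IS A RIGHT COMPOSITION WITH A DIAGONAL KERNEL**: `(x z ↦ K x z·ω z) = K ∘ (x z ↦ [x = z]·ω x)`. -/
theorem mul_diag_right : (fun x z (_ _ : Unit) => K x z () () * ω z)
    = comp K (fun x z (_ _ : Unit) => if x = z then ω x else 0) := by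
  funext x z a b
  obtain ⟨⟩ := a; obtain ⟨⟩ := b
  unfold ExpKernelCalculus.comp
  simp only [Finset.univ_unique, Finset.sum_singleton, PUnit.default_eq_unit]
  have e : (fun y => K x y PUnit.unit PUnit.unit * (if y = z then ω y else 0)) = fun y => if y = z then K x y () () * ω y else 0 := by
    funext y
    by_cases h : y = z
    · rw [if_pos h, if_pos h]
    · rw [if_neg h, if_neg h, mul_zero]
  rw [e, tsum_ite_eq]

/-- [folklore] **A ROW WEIGHT IS A LEFT COMPOSITION WITH A DIAGONAL KERNEL**: `(x z ↦ ω x·K x z) = (x z ↦ [x = z]·ω x) ∘ K`. -/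
theorem mul_diag_left : (fun x z (_ _ : Unit) => ω x * K x z () ())
    = comp (fun x z (_ _ : Unit) => if x = z then ω x else 0) K := by
  funext x z a b
  obtain ⟨⟩ := a; obtain ⟨⟩ := b
  unfold ExpKernelCalculus.comp
  simp only [Finset.univ_unique, Finset.sum_singleton, PUnit.default_eq_unit]
  have e : (fun y => (if x = y then ω x else 0) * K y z PUnit.unit PUnit.unit) = fun y => if x = y then ω y * K y z () () else 0 := by
    funext y
    by_cases h : x = y
    · subst h; rw [if_pos rfl, if_pos rfl]
    · rw [if_neg h, if_neg h, zero_mul]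
  rw [e, tsum_ite_eq']

/-- [folklore] The fibre mass of the diagonal kernel: `rowFn (x z ↦ [x = z]·ω x) 0 x z = [x = z]·|ω x|`. -/
theorem rowFn_diag (x z : Site 4) :
    rowFn (fun x z (_ _ : Unit) => if x = z then ω x else (0 : ℝ)) 0 x z = if x = z then |ω x| else 0 := by
  rw [rowFn_zero]
  simp only [Finset.univ_unique, Finset.sum_singleton]
  by_cases h : x = z
  · rw [if_pos h, if_pos h]
  · rw [if_neg h, if_neg h, abs_zero]

/-- [folklore] The rows of the diagonal kernel: `HasSum (rowFn D 0 x) |ω x|`. -/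
theorem hasSum_diag_row (x : Site 4) : HasSum (rowFn (fun x z (_ _ : Unit) => if x = z then ω x else (0 : ℝ)) 0 x) |ω x| := by
  have e : rowFn (fun x z (_ _ : Unit) => if x = z then ω x else (0 : ℝ)) 0 x = fun z => if x = z then |ω x| else 0 := by
    funext z; exact rowFn_diag ω x z
  rw [e]; exact hasSum_ite_eq' x _

/-- [folklore] The columns of the diagonal kernel: `HasSum (x ↦ rowFn D 0 x z) |ω z|`. -/
theorem hasSum_diag_col (z : Site 4) : HasSum (fun x => rowFn (fun x z (_ _ : Unit) => if x = z then ω x else (0 : ℝ)) 0 x z) |ω z| := by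
  have e : (fun x => rowFn (fun x z (_ _ : Unit) => if x = z then ω x else (0 : ℝ)) 0 x z) = fun x => if x = z then |ω z| else 0 := by
    funext x; rw [rowFn_diag]
    by_cases h : x = z
    · subst h; rfl
    · rw [if_neg h, if_neg h]
  rw [e]; exact hasSum_ite_eq z _

variable {ω}

/-- [folklore] **ROW MASS OF A DIAGONAL KERNEL**: `|ω x| ≤ Ω₀` for all `x` ⟹ `RowMass D 0 Ω₀`. -/
theorem rowMass_diag {Ω₀ : ℝ} (h : ∀ x, |ω x| ≤ Ω₀) : RowMass (fun x z (_ _ : Unit) => if x = z then ω x else (0 : ℝ)) 0 Ω₀ := fun x =>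
  ⟨(hasSum_diag_row ω x).summable, by rw [(hasSum_diag_row ω x).tsum_eq]; exact h x⟩

/-- [folklore] **COLUMN MASS OF A DIAGONAL KERNEL**. -/
theorem colMass_diag {Ω₀ : ℝ} (h : ∀ x, |ω x| ≤ Ω₀) : ColMass (fun x z (_ _ : Unit) => if x = z then ω x else (0 : ℝ)) 0 Ω₀ := fun z =>
  ⟨(hasSum_diag_col ω z).summable, by rw [(hasSum_diag_col ω z).tsum_eq]; exact h z⟩

/-- [folklore] The rows of a diagonal kernel are LOCALISED wherever `ω` is: `Σ'_z rowFn D 0 x z = |ω x| ≤ Φ x`. -/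
theorem rows_diag {Φ : Site 4 → ℝ} (h : ∀ x, |ω x| ≤ Φ x) (x : Site 4) :
    Summable (rowFn (fun x z (_ _ : Unit) => if x = z then ω x else (0 : ℝ)) 0 x) ∧
      ∑' z, rowFn (fun x z (_ _ : Unit) => if x = z then ω x else (0 : ℝ)) 0 x z ≤ Φ x :=
  ⟨(hasSum_diag_row ω x).summable, by rw [(hasSum_diag_row ω x).tsum_eq]; exact h x⟩

/-- [folklore] The columns of a diagonal kernel are localised wherever `ω` is. -/
theorem cols_diag {Φ : Site 4 → ℝ} (h : ∀ z, |ω z| ≤ Φ z) (z : Site 4) :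
    (Summable fun x => rowFn (fun x z (_ _ : Unit) => if x = z then ω x else (0 : ℝ)) 0 x z) ∧
      ∑' x, rowFn (fun x z (_ _ : Unit) => if x = z then ω x else (0 : ℝ)) 0 x z ≤ Φ z :=
  ⟨(hasSum_diag_col ω z).summable, by rw [(hasSum_diag_col ω z).tsum_eq]; exact h z⟩

/-- [folklore] **TOTAL MASS OF A GRAPH-SUPPORTED KERNEL** (one entry per row, at `z = φ x`): `Σ'|c| < ∞ ⟹ TotMass (x z ↦ [z = φ x]·c x) (Σ'_x |c x|)`. -/
theorem totMass_rowGraph {c : Site 4 → ℝ} (φ : Site 4 → Site 4) (hc : Summable fun x => |c x|) :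
    TotMass (fun x z (_ _ : Unit) => if z = φ x then c x else (0 : ℝ)) (∑' x, |c x|) := by
  set f : Site 4 × Site 4 → ℝ := fun p => ∑ a : Unit, ∑ b : Unit,
    |(fun x z (_ _ : Unit) => if z = φ x then c x else (0 : ℝ)) p.1 p.2 a b| with hf
  have hg : Function.Injective fun x : Site 4 => (x, φ x) := fun x y h => (Prod.mk.inj h).1
  have hfg : f ∘ (fun x : Site 4 => (x, φ x)) = fun x => |c x| := by
    funext x; simp [hf]
  have hzero : ∀ p, p ∉ Set.range (fun x : Site 4 => (x, φ x)) → f p = 0 := by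
    rintro ⟨x, z⟩ hp
    have hz : z ≠ φ x := fun h => hp ⟨x, by rw [h]⟩
    simp [hf, hz]
  have hsum : HasSum f (∑' x, |c x|) := by
    have h1 : HasSum (f ∘ fun x : Site 4 => (x, φ x)) (∑' x, |c x|) := by rw [hfg]; exact hc.hasSum
    exact (hg.hasSum_iff hzero).1 h1
  exact ⟨hsum.summable, hsum.tsum_eq.le⟩

/-- [folklore] The column twin (one entry per column, at `x = ψ z`): `TotMass (x z ↦ [x = ψ z]·c z) (Σ'_z |c z|)`. -/
theorem totMass_colGraph {c : Site 4 → ℝ} (ψ : Site 4 → Site 4) (hc : Summable fun z => |c z|) :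
    TotMass (fun x z (_ _ : Unit) => if x = ψ z then c z else (0 : ℝ)) (∑' z, |c z|) := by
  set f : Site 4 × Site 4 → ℝ := fun p => ∑ a : Unit, ∑ b : Unit,
    |(fun x z (_ _ : Unit) => if x = ψ z then c z else (0 : ℝ)) p.1 p.2 a b| with hf
  have hg : Function.Injective fun z : Site 4 => (ψ z, z) := fun x y h => (Prod.mk.inj h).2
  have hfg : f ∘ (fun z : Site 4 => (ψ z, z)) = fun z => |c z| := by
    funext z; simp [hf]
  have hzero : ∀ p, p ∉ Set.range (fun z : Site 4 => (ψ z, z)) → f p = 0 := by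
    rintro ⟨x, z⟩ hp
    have hx : x ≠ ψ z := fun h => hp ⟨z, by rw [h]⟩
    simp [hf, hx]
  have hsum : HasSum f (∑' z, |c z|) := by
    have h1 : HasSum (f ∘ fun z : Site 4 => (ψ z, z)) (∑' z, |c z|) := by rw [hfg]; exact hc.hasSum
    exact (hg.hasSum_iff hzero).1 h1
  exact ⟨hsum.summable, hsum.tsum_eq.le⟩

/-- [folklore] **TOTAL MASS OF A DIAGONAL KERNEL**: `TotMass (x z ↦ [x = z]·ω x) (Σ'_x |ω x|)`. -/
theorem totMass_diag (hω : Summable fun x => |ω x|) :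
    TotMass (fun x z (_ _ : Unit) => if x = z then ω x else (0 : ℝ)) (∑' x, |ω x|) := by
  have e : (fun x z (_ _ : Unit) => if x = z then ω x else (0 : ℝ)) = fun x z (_ _ : Unit) => if z = id x then ω x else 0 := by
    funext x z a b; simp only [id, eq_comm]
  rw [e]; exact totMass_rowGraph id hω

variable {K} {θ M : ℝ}

/-- [folklore] **ROW SHIFT** `x ↦ x + s` of a kernel: the θ-row mass grows by at most `e^{θ|s|₁}` (`θ ≥ 0`). -/
theorem rowMass_rowShift (h : RowMass K θ M) (hθ : 0 ≤ θ) (s : Site 4) :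
    RowMass (fun x y (a b : Unit) => K (x + s) y a b) θ (Real.exp (θ * l1 s) * M) := by
  intro x
  obtain ⟨hs, hle⟩ := h (x + s)
  have hpt : ∀ y, rowFn (fun x y (a b : Unit) => K (x + s) y a b) θ x y ≤ Real.exp (θ * l1 s) * rowFn K θ (x + s) y := by
    intro y
    rw [rowFn, rowFn, mul_left_comm, ← Real.exp_add]
    refine mul_le_mul_of_nonneg_left (Real.exp_le_exp.2 ?_) (Finset.sum_nonneg fun _ _ => Finset.sum_nonneg fun _ _ => abs_nonneg _)
    have := l1_sub_triangle x (x + s) y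
    have e : l1 (x - (x + s)) = l1 s := by rw [l1_sub_symm, add_sub_cancel_left]
    nlinarith
  refine ⟨(hs.mul_left _).of_nonneg_of_le (fun y => rowFn_nonneg _ _ _ _) hpt, ?_⟩
  calc ∑' y, rowFn (fun x y (a b : Unit) => K (x + s) y a b) θ x y
      ≤ ∑' y, Real.exp (θ * l1 s) * rowFn K θ (x + s) y :=
        Summable.tsum_le_tsum hpt ((hs.mul_left _).of_nonneg_of_le (fun y => rowFn_nonneg _ _ _ _) hpt) (hs.mul_left _)
    _ = Real.exp (θ * l1 s) * ∑' y, rowFn K θ (x + s) y := tsum_mul_left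
    _ ≤ Real.exp (θ * l1 s) * M := mul_le_mul_of_nonneg_left hle (Real.exp_pos _).le

/-- [folklore] Row shift at `θ = 0`: the row mass is unchanged. -/
theorem rowMass_rowShift_zero (h : RowMass K 0 M) (s : Site 4) : RowMass (fun x y (a b : Unit) => K (x + s) y a b) 0 M := by
  simpa using rowMass_rowShift h le_rfl s

/-- [folklore] **COLUMN SHIFT** `z ↦ z + t`: the θ-row mass grows by at most `e^{θ|t|₁}` (`θ ≥ 0`). -/
theorem rowMass_colShift (h : RowMass K θ M) (hθ : 0 ≤ θ) (t : Site 4) :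
    RowMass (fun y z (a b : Unit) => K y (z + t) a b) θ (Real.exp (θ * l1 t) * M) := by
  intro y
  obtain ⟨hs, hle⟩ := h y
  have hpt : ∀ z, rowFn (fun y z (a b : Unit) => K y (z + t) a b) θ y z ≤ Real.exp (θ * l1 t) * rowFn K θ y (z + t) := by
    intro z
    rw [rowFn, rowFn, mul_left_comm, ← Real.exp_add]
    refine mul_le_mul_of_nonneg_left (Real.exp_le_exp.2 ?_) (Finset.sum_nonneg fun _ _ => Finset.sum_nonneg fun _ _ => abs_nonneg _)
    have := l1_sub_triangle y (z + t) z
    have e : l1 (z + t - z) = l1 t := by rw [add_sub_cancel_left]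
    nlinarith
  have hs' : Summable fun z => Real.exp (θ * l1 t) * rowFn K θ y (z + t) :=
    ((Equiv.addRight t).summable_iff.2 hs).mul_left _
  refine ⟨hs'.of_nonneg_of_le (fun z => rowFn_nonneg _ _ _ _) hpt, ?_⟩
  have hshift := Equiv.tsum_eq (Equiv.addRight t) (fun z => rowFn K θ y z)
  simp only [Equiv.coe_addRight] at hshift
  calc ∑' z, rowFn (fun y z (a b : Unit) => K y (z + t) a b) θ y z
      ≤ ∑' z, Real.exp (θ * l1 t) * rowFn K θ y (z + t) :=
        Summable.tsum_le_tsum hpt (hs'.of_nonneg_of_le (fun z => rowFn_nonneg _ _ _ _) hpt) hs'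
    _ = Real.exp (θ * l1 t) * ∑' z, rowFn K θ y z := by rw [tsum_mul_left, hshift]
    _ ≤ Real.exp (θ * l1 t) * M := mul_le_mul_of_nonneg_left hle (Real.exp_pos _).le

/-- [folklore] **COLUMN MASS UNDER A TWO-SIDED SHIFT** at `θ = 0`: unchanged. -/
theorem colMass_shift2_zero (h : ColMass K 0 M) (s t : Site 4) : ColMass (fun x z (a b : Unit) => K (x + s) (z + t) a b) 0 M := by
  intro z
  obtain ⟨hs, hle⟩ := h (z + t)
  have e : (fun x => rowFn (fun x z (a b : Unit) => K (x + s) (z + t) a b) 0 x z) = (fun x => rowFn K 0 x (z + t)) ∘ (Equiv.addRight s) := by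
    funext x; simp [rowFn]
  rw [e]
  exact ⟨(Equiv.summable_iff _).2 hs, (Equiv.tsum_eq (Equiv.addRight s) (fun x => rowFn K 0 x (z + t))).trans_le hle⟩

/-- [folklore] **LOCALISED COLUMNS UNDER A TWO-SIDED SHIFT**: columns localised at `c` with rate `κ ≥ 0` stay localised, amplitude `× e^{κ|t|₁}`. -/
theorem cols_shift2 {ωV κ : ℝ} {c : Site 4}
    (h : ∀ y, (Summable fun x => rowFn K 0 x y) ∧ ∑' x, rowFn K 0 x y ≤ ωV * Real.exp (-κ * l1 (y - c)))
    (hκ : 0 ≤ κ) (hωV : 0 ≤ ωV) (s t : Site 4) (y : Site 4) :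
    (Summable fun x => rowFn (fun x z (a b : Unit) => K (x + s) (z + t) a b) 0 x y) ∧
      ∑' x, rowFn (fun x z (a b : Unit) => K (x + s) (z + t) a b) 0 x y ≤ ωV * Real.exp (κ * l1 t) * Real.exp (-κ * l1 (y - c)) := by
  obtain ⟨hs, hle⟩ := h (y + t)
  have e : (fun x => rowFn (fun x z (a b : Unit) => K (x + s) (z + t) a b) 0 x y) = (fun x => rowFn K 0 x (y + t)) ∘ (Equiv.addRight s) := by
    funext x; simp [rowFn]
  rw [e]
  refine ⟨(Equiv.summable_iff _).2 hs, ((Equiv.tsum_eq (Equiv.addRight s) (fun x => rowFn K 0 x (y + t))).trans_le hle).trans ?_⟩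
  rw [mul_assoc, ← Real.exp_add]
  refine mul_le_mul_of_nonneg_left (Real.exp_le_exp.2 ?_) hωV
  have := l1_sub_triangle y (y + t) c
  have e2 : l1 (y - (y + t)) = l1 t := by rw [l1_sub_symm, add_sub_cancel_left]
  nlinarith

variable {κ : ℝ} {c c' : Site 4} {Ω : ℝ}

/-- [folklore] A localised weight is bounded: `|ω z| ≤ Ω·e^{−κ|z−c′|₁} ≤ Ω` (`κ ≥ 0`). -/
theorem weight_le (hω : ∀ z, |ω z| ≤ Ω * Real.exp (-κ * l1 (z - c'))) (hκ : 0 ≤ κ) (z : Site 4) : |ω z| ≤ Ω := by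
  have hΩ : 0 ≤ Ω := by
    have h := hω c'
    rw [sub_self, l1_zero, mul_zero, Real.exp_zero, mul_one] at h
    exact (abs_nonneg _).trans h
  refine (hω z).trans (mul_le_of_le_one_right hΩ ?_)
  rw [Real.exp_le_one_iff]
  nlinarith [l1_nonneg (z - c')]

/-- [folklore] **THE PRODUCT OF TWO LOCALISED WEIGHTS IS SUMMABLE, WITH THE SEPARATION FACTOR**: `|ϖ z| ≤ P₀·e^{−κ|z−c|₁}·e^{−κ|z−c′|₁}`, `0 ≤ θ < κ`
⟹ `Σ'_z |ϖ z| ≤ P₀·Zl 4 (κ−θ)·e^{−θ|c−c′|₁}`. -/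
theorem tsum_prodWeight_le {ϖ : Site 4 → ℝ} {P0 : ℝ}
    (hϖ : ∀ z, |ϖ z| ≤ P0 * Real.exp (-κ * l1 (z - c)) * Real.exp (-κ * l1 (z - c'))) (hθ : 0 ≤ θ) (hθκ : θ < κ) :
    (Summable fun z => |ϖ z|) ∧ ∑' z, |ϖ z| ≤ P0 * Zl 4 (κ - θ) * Real.exp (-θ * l1 (c - c')) := by
  have hP0 : 0 ≤ P0 := by
    have h := hϖ c
    rw [sub_self, l1_zero, mul_zero, Real.exp_zero, mul_one] at h
    exact le_of_mul_le_mul_right (by rw [zero_mul]; exact (abs_nonneg _).trans h) (Real.exp_pos _)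
  have hpt : ∀ z, |ϖ z| ≤ P0 * Real.exp (-θ * l1 (c - c')) * Real.exp (-(κ - θ) * l1 (z - c)) := by
    intro z
    refine (hϖ z).trans ?_
    rw [mul_assoc, mul_assoc, ← Real.exp_add, ← Real.exp_add]
    refine mul_le_mul_of_nonneg_left (Real.exp_le_exp.2 ?_) hP0
    have h1 : l1 (c - c') ≤ l1 (c - z) + l1 (z - c') := l1_sub_triangle c z c'
    have h2 : l1 (c - z) = l1 (z - c) := l1_sub_symm c z
    nlinarith [l1_nonneg (z - c'), l1_nonneg (z - c)]
  have hs : Summable fun z => P0 * Real.exp (-θ * l1 (c - c')) * Real.exp (-(κ - θ) * l1 (z - c)) :=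
    (summable_exp_shift' (by linarith) c).mul_left _
  refine ⟨hs.of_nonneg_of_le (fun z => abs_nonneg _) hpt, ?_⟩
  calc ∑' z, |ϖ z| ≤ ∑' z, P0 * Real.exp (-θ * l1 (c - c')) * Real.exp (-(κ - θ) * l1 (z - c)) :=
        Summable.tsum_le_tsum hpt (hs.of_nonneg_of_le (fun z => abs_nonneg _) hpt) hs
    _ = P0 * Zl 4 (κ - θ) * Real.exp (-θ * l1 (c - c')) := by rw [tsum_mul_left, tsum_exp_shift']; ring

end DiagShift

end Summit.QuantumFields.BalabanUV.Beta.D1BFx.CoframeWordShapes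

end
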